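import Literature.NumberTheory.Automorphic.GJUnfoldingCosets
import Literature.NumberTheory.Automorphic.CosetIntegral
import Literature.NumberTheory.Automorphic.AdelicSecondCountable
import Literature.NumberTheory.Automorphic.AdelicGroupDataGLnProofs
import Mathlib.MeasureTheory.Integral.Prod
import Mathlib.MeasureTheory.Measure.Haar.Unique
import Mathlib.Topology.Algebra.Group.Matrix
import Mathlib.Analysis.SpecialFunctions.Pow.Continuity
import Literature.NumberTheory.Automorphic.IdeleClassGroupProofs

/-!
# The Godement–Jacquet integral unfolded along `GL_n(𝔸_K) = H^T · G_T`

Topic `NumberTheory/Automorphic`; namespace `Literature.NumberTheory.Automorphic`. Fourth brick of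
the `K^T`-spherical unfolding of the global Godement–Jacquet zeta integral
`Z(Φ, s, φ, φ') = ∫_{GL_n(𝔸_K)} Φ(x) ⟪φ', R(x) φ⟫ |det x|_𝔸^s dx` (`gjZeta`, `GodementJacquetZetaIntegrals`)
towards the discharge of `GodementJacquet1972_gjZeta_eulerFactorisation` (Godement–Jacquet, LNM 260,
Theorem 11.2 via Lemma 6.10): after `GJUnfoldingLocal` (one place), `GJUnfoldingCosets` (the coset
sum over all places outside `T`: `hasSum_unfoldTerm_intCosetsAway`) and `CosetIntegral` (integrals of
right-`K`-invariant functions as coset sums), this file performs the measure-theoretic step.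

For a finite set `T` of finite places let `H^T = awayFactor K n T` (adelic matrices trivial at `T`
and at `∞`), `G_T = placesFactor K n T` (trivial at the finite places outside `T`),
`K^T = awayLevelIn K n T = ∏_{w ∉ T} GL_n(𝒪_w) ≤ H^T` and `Δ^T = {h ∈ H^T | h_w ∈ M_n(𝒪_w) ∀ w}`.

* `integral_indicator_unfold_awayFactor` : for `Π` cuspidal with Satake family `α` off `T`,
  `0 ≠ φ ∈ Π^{K^T}`, `ψ ∈ L²` and `Re s ≥ n² + n + 2`, the function `h ↦ 1_{Δ^T}(h) |det h|_𝔸^s ⟪ψ, R(h) φ⟫`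
  is integrable on `H^T` for any Haar measure `dh` and
  `∫_{H^T} 1_{Δ^T}(h) |det h|_𝔸^s ⟪ψ, R(h) φ⟫ dh = vol(K^T) · (∏'_{w ∉ T} L_w(s)) · ⟪ψ, φ⟫`,
  `L_w(s) = localEulerInv n (α w) w s` (the coset sum of `GJUnfoldingCosets` integrated coset by coset,
  `integral_setOf_mk_mem_eq_tsum`).
* `awayDecomp K n T : GL_n(𝔸_K) ≃ₜ* H^T × G_T` (the accepted `truncGLContinuousEquiv` at the idempotent
  `e^T`), `awayProductMeasure K n T μH μG` = the transport of `μH ⊗ μG`, a Haar measure on `GL_n(𝔸_K)`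
  (`isHaarMeasure_awayProductMeasure`; Mathlib `MulEquiv.isHaarMeasure_map`, `Measure.prod.instIsHaarMeasure`).
* `gjZeta_awayProductMeasure_eq` (**main**) : if `Φ(h a) = 1_{Δ^T}(h) Φ_G(a)` on `H^T × G_T`, `Φ` is
  continuous on `GL_n(𝔸_K)` and `a ↦ |Φ_G(a)| |det a|_𝔸^{Re s}` is `μG`-integrable, then the
  Godement–Jacquet integrand is integrable for `dh ⊗ da` and
  `Z(Φ, s, φ, φ') = vol(K^T) · (∏'_{w ∉ T} L_w(s)) · ∫_{G_T} Φ_G(a) ⟪φ', R(a) φ⟫ |det a|_𝔸^s da`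
  (Fubini–Tonelli, `R(a) φ ∈ Π^{K^T}` again since `G_T` commutes with `K^T ≤ H^T`, and the first bullet
  with `ψ = φ'`, `φ ↦ R(a) φ`).

Supporting results: `H^T`, `G_T` are closed, locally compact, second countable; `K^T ≤ H^T` is
compact open with countable coset space; `Δ^T` is open; `|det|_𝔸`, `|det|_𝔸^s` and the matrix
coefficient are continuous on `GL_n(𝔸_K)`; `integrable_indicator_adelicAbsDet_rpow` (the weights
`1_{Δ^T} |det|^σ` are integrable for `σ ≥ n² + n + 2`, from `summable_unfoldWeight`).

Design notes. (1) Everything is stated for arbitrary Haar measures `μH`, `μG` on the closed subgroups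
(instance hypotheses `[MeasurableSpace] [BorelSpace]` on the subtypes, as in `CosetIntegral`); the
consumer compares `awayProductMeasure` with a given Haar measure on `GL_n(𝔸_K)` by uniqueness.
(2) The threshold `n² + n + 2 ≤ Re s` is the (crude) one of `GJUnfoldingCosets.hasSum_unfoldTerm_intCosetsAway`
(trivial Satake bound `|α_{w,i}| ≤ q_w^{n+1/2}`, coset count `#Δ_m ≤ (2^n q^{n²})^m`); it is harmless for
the Euler factorisation, which only needs some right half-plane. (3) No named facts are introduced;
the file discharges nothing by itself and feeds `GJUnfoldingData` / the Euler-factorisation proof.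

References: R. Godement, H. Jacquet, *Zeta functions of simple algebras*, LNM 260 (1972), §§10–12
(Theorem 11.2, Lemma 6.10, the unfolding on pp. 150–155); H. Jacquet, *Principal L-functions of the
linear group*, Proc. Symp. Pure Math. 33.2 (1979), §1 and (6.1.5); D. Bump, *Automorphic Forms and
Representations* (1997), §3.5 (spherical unfolding for `GL_2`).
-/

noncomputable section

open scoped MatrixGroups NNReal InnerProductSpace Topology ENNReal
open NumberField IsDedekindDomain Literature.LinearAlgebra.Matrix MeasureTheory Filter

namespace Literature.NumberTheory.Automorphic

/-! ### Topology of the factors `H^T`, `G_T` and of the level `K^T` -/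

section Topology

variable (K : Type) [Field K] [NumberField K] (n : ℕ) (T : Finset (HeightOneSpectrum (𝓞 K)))

/-- The factor `G_T = GL_n(𝔸_{K,T ∪ ∞}) ≤ GL_n(𝔸_K)` of adelic matrices trivial at the finite places
outside `T` (the range of the truncation at `1 - e^T`, `AdelicTruncation`). [folklore] -/
abbrev placesFactor : Subgroup (GL (Fin n) (AdeleRing (𝓞 K) K)) :=
  (truncGL (Fin n) (isIdempotentElem_adeleAwayIdem K T).one_sub).range

/-- `H^T` is closed in `GL_n(𝔸_K)` (the fixed points of the continuous idempotent `π_{e^T}`). [folklore] -/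
theorem isClosed_awayFactor : IsClosed (awayFactor K n T : Set (GL (Fin n) (AdeleRing (𝓞 K) K))) := by
  haveI := t2Space_gl n K
  have h : (awayFactor K n T : Set (GL (Fin n) (AdeleRing (𝓞 K) K))) =
      {g | truncGL (Fin n) (isIdempotentElem_adeleAwayIdem K T) g = g} :=
    Set.ext fun g => mem_range_truncGL_iff_eq _ g
  rw [h]
  exact isClosed_eq (continuous_truncGL _) continuous_id

/-- `G_T` is closed in `GL_n(𝔸_K)`. [folklore] -/
theorem isClosed_placesFactor : IsClosed (placesFactor K n T : Set (GL (Fin n) (AdeleRing (𝓞 K) K))) := by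
  haveI := t2Space_gl n K
  have h : (placesFactor K n T : Set (GL (Fin n) (AdeleRing (𝓞 K) K))) =
      {g | truncGL (Fin n) (isIdempotentElem_adeleAwayIdem K T).one_sub g = g} :=
    Set.ext fun g => mem_range_truncGL_iff_eq _ g
  rw [h]
  exact isClosed_eq (continuous_truncGL _) continuous_id

/-- `H^T` is locally compact (closed in the locally compact `GL_n(𝔸_K)`). [folklore] -/
theorem locallyCompactSpace_awayFactor : LocallyCompactSpace (awayFactor K n T) := by
  haveI : LocallyCompactSpace (GL (Fin n) (AdeleRing (𝓞 K) K)) :=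
    AdelicGroupData.locallyCompactSpace_gl_adelic_holds n K
  exact (isClosed_awayFactor K n T).locallyCompactSpace

/-- `G_T` is locally compact. [folklore] -/
theorem locallyCompactSpace_placesFactor : LocallyCompactSpace (placesFactor K n T) := by
  haveI : LocallyCompactSpace (GL (Fin n) (AdeleRing (𝓞 K) K)) :=
    AdelicGroupData.locallyCompactSpace_gl_adelic_holds n K
  exact (isClosed_placesFactor K n T).locallyCompactSpace

/-- `H^T` is second countable. [folklore] -/
theorem secondCountableTopology_awayFactor : SecondCountableTopology (awayFactor K n T) := by
  haveI : SecondCountableTopology (GL (Fin n) (AdeleRing (𝓞 K) K)) :=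
    secondCountableTopology_generalLinearGroup_adeleRing K (Fin n)
  exact TopologicalSpace.Subtype.secondCountableTopology (awayFactor K n T : Set (GL (Fin n) (AdeleRing (𝓞 K) K)))

/-- `G_T` is second countable. [folklore] -/
theorem secondCountableTopology_placesFactor : SecondCountableTopology (placesFactor K n T) := by
  haveI : SecondCountableTopology (GL (Fin n) (AdeleRing (𝓞 K) K)) :=
    secondCountableTopology_generalLinearGroup_adeleRing K (Fin n)
  exact TopologicalSpace.Subtype.secondCountableTopology (placesFactor K n T : Set (GL (Fin n) (AdeleRing (𝓞 K) K)))

/-- `K^T` is open in `H^T` (`awayLevel_eq_range_inf_comap`, `isOpen_comap_sndHom_glFiniteIntegralLevel`). [folklore] -/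
theorem isOpen_awayLevelIn : IsOpen (awayLevelIn K n T : Set (awayFactor K n T)) := by
  have h : (awayLevelIn K n T : Set (awayFactor K n T)) =
      Subtype.val ⁻¹' ((glFiniteIntegralLevel n K).comap (GLn.sndHom n K) : Set (GL (Fin n) (AdeleRing (𝓞 K) K))) := by
    ext x
    simp only [SetLike.mem_coe, Subgroup.mem_subgroupOf, Set.mem_preimage]
    rw [awayLevel_eq_range_inf_comap, Subgroup.mem_inf]
    exact ⟨fun h => h.2, fun h => ⟨x.2, h⟩⟩
  rw [h]
  exact (isOpen_comap_sndHom_glFiniteIntegralLevel n).preimage continuous_subtype_val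

/-- `K^T` is compact in `H^T` (`isCompact_awayLevel`; `H^T` is closed). [folklore] -/
theorem isCompact_awayLevelIn : IsCompact (awayLevelIn K n T : Set (awayFactor K n T)) := by
  have h : (awayLevelIn K n T : Set (awayFactor K n T)) =
      Subtype.val ⁻¹' (awayLevel K n T : Set (GL (Fin n) (AdeleRing (𝓞 K) K))) := rfl
  rw [h]
  exact (isClosed_awayFactor K n T).isClosedEmbedding_subtypeVal.isCompact_preimage (isCompact_awayLevel n T)

/-- `H^T / K^T` is countable (the cosets of the open subgroup `K^T` are disjoint open subsets of the
second countable `H^T`). [folklore] -/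
theorem countable_quotient_awayLevelIn : Countable (awayFactor K n T ⧸ awayLevelIn K n T) := by
  haveI := secondCountableTopology_awayFactor K n T
  have h : (Set.univ : Set (awayFactor K n T ⧸ awayLevelIn K n T)).Countable := by
    refine Set.PairwiseDisjoint.countable_of_isOpen (s := fun γ => {x : awayFactor K n T |
      (x : awayFactor K n T ⧸ awayLevelIn K n T) = γ}) (fun γ _ γ' _ h => disjoint_setOf_mk_eq _ h)
      (fun γ _ => isOpen_setOf_mk_eq (isOpen_awayLevelIn K n T) γ) (fun γ _ => ⟨γ.out, QuotientGroup.out_eq' γ⟩)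
  exact Set.countable_univ_iff.1 h

end Topology

/-! ### The coset integral over `H^T` -/

section AwayIntegral

open scoped Classical

variable {K : Type} [Field K] [NumberField K] {n : ℕ} {T : Finset (HeightOneSpectrum (𝓞 K))}

/-- The set `Δ^T ⊆ H^T` of integral elements is the union of the integral cosets. [folklore] -/
theorem setOf_isIntegralAway_eq :
    {x : awayFactor K n T | IsIntegralAway x} =
      {x : awayFactor K n T | (x : awayFactor K n T ⧸ awayLevelIn K n T) ∈ intCosetsAway K n T} := by
  ext x
  exact (mk_mem_intCosetsAway_iff x).symm

/-- `Δ^T` is open in `H^T` (a union of cosets of the open `K^T`). [folklore] -/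
theorem isOpen_setOf_isIntegralAway : IsOpen {x : awayFactor K n T | IsIntegralAway x} := by
  rw [setOf_isIntegralAway_eq]
  have h : {x : awayFactor K n T | (x : awayFactor K n T ⧸ awayLevelIn K n T) ∈ intCosetsAway K n T} =
      ⋃ γ ∈ intCosetsAway K n T, {x : awayFactor K n T | (x : awayFactor K n T ⧸ awayLevelIn K n T) = γ} := by
    ext x; simp
  rw [h]
  exact isOpen_biUnion fun γ _ => isOpen_setOf_mk_eq (isOpen_awayLevelIn K n T) γ

variable [MeasurableSpace (awayFactor K n T)] [BorelSpace (awayFactor K n T)]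
  (μH : Measure (awayFactor K n T)) [μH.IsMulLeftInvariant] [IsFiniteMeasureOnCompacts μH]

omit [BorelSpace (awayFactor K n T)] [μH.IsMulLeftInvariant] in
/-- `K^T` has finite Haar measure in `H^T`. [folklore] -/
theorem measure_awayLevelIn_lt_top : μH (awayLevelIn K n T) < ⊤ :=
  (isCompact_awayLevelIn K n T).measure_lt_top

/-- **The weights are integrable on `Δ^T`**: `∫_{Δ^T} |det h|_𝔸^σ dh = vol(K^T) ∑_{x K^T} |det x|_𝔸^σ < ∞`
for `σ ≥ n² + n + 2`. [folklore] -/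
theorem integrable_indicator_adelicAbsDet_rpow {σ : ℝ} (hσ : (n : ℝ) * n + n + 2 ≤ σ) :
    Integrable (fun h : awayFactor K n T => {x : awayFactor K n T | IsIntegralAway x}.indicator
      (fun h => (adelicAbsDet n K (h : GL (Fin n) (AdeleRing (𝓞 K) K)) : ℝ) ^ σ) h) μH ∧
    ∫ h, {x : awayFactor K n T | IsIntegralAway x}.indicator
        (fun h => (adelicAbsDet n K (h : GL (Fin n) (AdeleRing (𝓞 K) K)) : ℝ) ^ σ) h ∂μH =
      (μH (awayLevelIn K n T)).toReal * ∑' γ : intCosetsAway K n T, unfoldWeight K n T σ γ.1 := by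
  haveI := countable_quotient_awayLevelIn K n T
  set F : awayFactor K n T → ℝ := fun h => (adelicAbsDet n K (h : GL (Fin n) (AdeleRing (𝓞 K) K)) : ℝ) ^ σ
    with hFdef
  have hF : ∀ (x : awayFactor K n T), ∀ k ∈ awayLevelIn K n T, F (x * k) = F x := fun x k hk => by
    rw [hFdef]
    dsimp only
    rw [Subgroup.coe_mul, map_mul, adelicAbsDet_eq_one_of_mem_awayLevelIn hk, mul_one]
  have hFout : ∀ γ : intCosetsAway K n T, F (γ.1.out : awayFactor K n T) = unfoldWeight K n T σ γ.1 :=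
    fun γ => rfl
  have hsum : Summable fun γ : intCosetsAway K n T => ‖F (γ.1.out : awayFactor K n T)‖ := by
    refine (summable_unfoldWeight (T := T) hσ).congr fun γ => ?_
    rw [hFout, Real.norm_of_nonneg (unfoldWeight_nonneg σ γ.1)]
  obtain ⟨hint, hval⟩ := integral_setOf_mk_mem_eq_tsum (μ := μH) (isOpen_awayLevelIn K n T)
    (measure_awayLevelIn_lt_top μH) hF (Set.to_countable _) hsum
  rw [← setOf_isIntegralAway_eq] at hint hval
  refine ⟨(integrable_indicator_iff isOpen_setOf_isIntegralAway.measurableSet).2 hint, ?_⟩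
  rw [integral_indicator isOpen_setOf_isIntegralAway.measurableSet, hval, smul_eq_mul]
  simp only [hFout]

variable {μ : Measure (AdelicGroupData.gl n K).automorphicQuotient}
  [(AdelicGroupData.gl n K).IsAutomorphicMeasure μ]

/-- **The unfolded integral over `H^T`.** For `Π` cuspidal with Satake family `α` off `T`,
`0 ≠ φ ∈ Π^{K^T}`, `ψ ∈ L²`, a left-invariant measure `μH` on `H^T` finite on compacts and
`re s ≥ n² + n + 2`:
`∫_{H^T} 1_{Δ^T}(h) |det h|_𝔸^s ⟪ψ, R(h) φ⟫ dμH(h) = μH(K^T) · (∏_{w ∉ T} (∏_{a ∈ α w} (1 - q_w^{(n-1)/2} a q_w^{-s}))⁻¹) · ⟪ψ, φ⟫`,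
with an integrable integrand (coset integral `CosetIntegral.integral_setOf_mk_mem_eq_tsum` over the
countably many cosets of the compact open `K^T ≤ H^T`, then `hasSum_unfoldTerm_intCosetsAway`).
This is the away-from-`T` factor of `Z(Φ, s, φ, φ')` for `Φ = Φ_T ⊗ 1_{M_n(𝒪̂^T)}`
(Godement–Jacquet (1972), proof of Thm. 13.8 with Lemma 6.10). [cite: GodementJacquet1972, Lemma 6.10] -/
theorem integral_indicator_unfold_awayFactor (P : CuspidalAutomorphicRepGL n K μ) {α : SatakeFamily K}
    (hα : IsSatakeFamilyOf P (↑T : Set (HeightOneSpectrum (𝓞 K))) α)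
    {φ : (AdelicGroupData.gl n K).L2 μ} (hφP : φ ∈ P.1) (hφ0 : φ ≠ 0)
    (hφ : ∀ k ∈ awayLevel K n T, (AdelicGroupData.gl n K).rightRegular μ k φ = φ)
    (ψ : (AdelicGroupData.gl n K).L2 μ) {s : ℂ} (hs : (n : ℝ) * n + n + 2 ≤ s.re) :
    Integrable (fun h : awayFactor K n T => {x : awayFactor K n T | IsIntegralAway x}.indicator
      (fun h => ((adelicAbsDet n K (h : GL (Fin n) (AdeleRing (𝓞 K) K)) : ℝ) : ℂ) ^ s *
        ⟪ψ, (AdelicGroupData.gl n K).rightRegular μ (h : GL (Fin n) (AdeleRing (𝓞 K) K)) φ⟫_ℂ) h) μH ∧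
    ∫ h, {x : awayFactor K n T | IsIntegralAway x}.indicator
      (fun h => ((adelicAbsDet n K (h : GL (Fin n) (AdeleRing (𝓞 K) K)) : ℝ) : ℂ) ^ s *
        ⟪ψ, (AdelicGroupData.gl n K).rightRegular μ (h : GL (Fin n) (AdeleRing (𝓞 K) K)) φ⟫_ℂ) h ∂μH =
      ((μH (awayLevelIn K n T)).toReal : ℂ) *
        ((∏' i : {w : HeightOneSpectrum (𝓞 K) // w ∉ T}, localEulerInv n (α i.1) i.1 s) * ⟪ψ, φ⟫_ℂ) := by
  haveI := countable_quotient_awayLevelIn K n T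
  set F : awayFactor K n T → ℂ := fun h => ((adelicAbsDet n K (h : GL (Fin n) (AdeleRing (𝓞 K) K)) : ℝ) : ℂ) ^ s *
    ⟪ψ, (AdelicGroupData.gl n K).rightRegular μ (h : GL (Fin n) (AdeleRing (𝓞 K) K)) φ⟫_ℂ with hFdef
  have hF : ∀ (x : awayFactor K n T), ∀ k ∈ awayLevelIn K n T, F (x * k) = F x := fun x k hk => by
    rw [hFdef]
    dsimp only
    rw [Subgroup.coe_mul, map_mul, adelicAbsDet_eq_one_of_mem_awayLevelIn hk, mul_one, rightRegular_mul_apply,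
      hφ _ (Subgroup.mem_subgroupOf.1 hk)]
  have hFout : ∀ γ : intCosetsAway K n T, F (γ.1.out : awayFactor K n T) = unfoldTerm K n T μ φ ψ s γ.1 :=
    fun γ => rfl
  have hsum : Summable fun γ : intCosetsAway K n T => ‖F (γ.1.out : awayFactor K n T)‖ := by
    refine (summable_norm_unfoldTerm (T := T) φ ψ hs).congr fun γ => ?_
    rw [hFout]
  obtain ⟨hint, hval⟩ := integral_setOf_mk_mem_eq_tsum (μ := μH) (isOpen_awayLevelIn K n T)
    (measure_awayLevelIn_lt_top μH) hF (Set.to_countable _) hsum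
  rw [← setOf_isIntegralAway_eq] at hint hval
  refine ⟨(integrable_indicator_iff isOpen_setOf_isIntegralAway.measurableSet).2 hint, ?_⟩
  rw [integral_indicator isOpen_setOf_isIntegralAway.measurableSet, hval]
  simp only [hFout]
  rw [(hasSum_unfoldTerm_intCosetsAway P hα hφP hφ0 hφ ψ hs).2.tsum_eq, Complex.real_smul]

end AwayIntegral

/-! ### `GL_n(𝔸_K) = H^T · G_T`: the product Haar measure and the unfolding of `Z(Φ, s, φ, φ')` -/

section Product

open scoped Classical

variable (K : Type) [Field K] [NumberField K] (n : ℕ) (T : Finset (HeightOneSpectrum (𝓞 K)))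

/-- The decomposition `GL_n(𝔸_K) ≃ₜ* H^T × G_T`, `g ↦ (π_{e^T} g, π_{1-e^T} g)` with inverse
`(h, a) ↦ h a` (`truncGLContinuousEquiv` of `GLIdempotentDecomposition`). [folklore] -/
abbrev awayDecomp : GL (Fin n) (AdeleRing (𝓞 K) K) ≃ₜ* awayFactor K n T × placesFactor K n T :=
  truncGLContinuousEquiv (isIdempotentElem_adeleAwayIdem K T)

variable {K n T}

/-- The inverse of `awayDecomp` is multiplication. [folklore] -/
theorem awayDecomp_symm_apply (p : awayFactor K n T × placesFactor K n T) :
    (awayDecomp K n T).symm p = (p.1 : GL (Fin n) (AdeleRing (𝓞 K) K)) * (p.2 : GL (Fin n) (AdeleRing (𝓞 K) K)) := rfl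

/-- Elements of `H^T` and `G_T` commute (`truncGL_comm`). [folklore] -/
theorem coe_awayFactor_mul_comm (h : awayFactor K n T) (a : placesFactor K n T) :
    (h : GL (Fin n) (AdeleRing (𝓞 K) K)) * (a : GL (Fin n) (AdeleRing (𝓞 K) K)) =
      (a : GL (Fin n) (AdeleRing (𝓞 K) K)) * (h : GL (Fin n) (AdeleRing (𝓞 K) K)) := by
  obtain ⟨g, hg⟩ := h.2
  obtain ⟨g', hg'⟩ := a.2
  rw [← hg, ← hg']
  exact truncGL_comm _ g g'

variable {μ : Measure (AdelicGroupData.gl n K).automorphicQuotient}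
  [(AdelicGroupData.gl n K).IsAutomorphicMeasure μ]

/-- **`R(a) φ` is again `K^T`-fixed for `a ∈ G_T`** (`K^T ≤ H^T` commutes with `G_T`). [folklore] -/
theorem rightRegular_placesFactor_fixed {φ : (AdelicGroupData.gl n K).L2 μ}
    (hφ : ∀ k ∈ awayLevel K n T, (AdelicGroupData.gl n K).rightRegular μ k φ = φ) (a : placesFactor K n T) :
    ∀ k ∈ awayLevel K n T, (AdelicGroupData.gl n K).rightRegular μ k
      ((AdelicGroupData.gl n K).rightRegular μ (a : GL (Fin n) (AdeleRing (𝓞 K) K)) φ) =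
        (AdelicGroupData.gl n K).rightRegular μ (a : GL (Fin n) (AdeleRing (𝓞 K) K)) φ := by
  intro k hk
  have hcomm := coe_awayFactor_mul_comm (⟨k, awayLevel_le_range n T hk⟩ : awayFactor K n T) a
  dsimp only at hcomm
  rw [← rightRegular_mul_apply, hcomm, rightRegular_mul_apply, hφ k hk]

/-- `R(a) φ ≠ 0` for `φ ≠ 0` (`R(a)` is an isometry). [folklore] -/
theorem rightRegular_apply_ne_zero {φ : (AdelicGroupData.gl n K).L2 μ} (hφ0 : φ ≠ 0)
    (g : GL (Fin n) (AdeleRing (𝓞 K) K)) : (AdelicGroupData.gl n K).rightRegular μ g φ ≠ 0 := by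
  intro h
  have h1 := AdelicGroupData.norm_rightRegular_apply (𝒢 := AdelicGroupData.gl n K) μ g φ
  rw [h, norm_zero] at h1
  exact hφ0 (norm_eq_zero.1 h1.symm)

/-- The matrix coefficient `x ↦ ⟪φ', R(x) φ⟫` is continuous (strong continuity of `R`). [folklore] -/
theorem continuous_glMatrixCoeff (φ φ' : (AdelicGroupData.gl n K).L2 μ) :
    Continuous fun x : GL (Fin n) (AdeleRing (𝓞 K) K) => glMatrixCoeff μ φ φ' x :=
  continuous_const.inner ((AdelicGroupData.gl n K).isStronglyContinuous_rightRegular_holds μ φ)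

/-- `x ↦ |det x|_𝔸` is continuous (`continuous_ideleNorm_holds`, continuity of `det`). [folklore] -/
theorem continuous_adelicAbsDet : Continuous fun x : GL (Fin n) (AdeleRing (𝓞 K) K) => (adelicAbsDet n K x : ℝ) :=
  NNReal.continuous_coe.comp ((continuous_ideleNorm_holds K).comp Matrix.GeneralLinearGroup.continuous_det)

/-- `x ↦ |det x|_𝔸^s` is continuous (`|det x|_𝔸 > 0` lies in the slit plane). [folklore] -/
theorem continuous_adelicAbsDet_cpow (s : ℂ) :
    Continuous fun x : GL (Fin n) (AdeleRing (𝓞 K) K) => ((adelicAbsDet n K x : ℝ) : ℂ) ^ s :=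
  (Complex.continuous_ofReal.comp continuous_adelicAbsDet).cpow continuous_const fun x =>
    Complex.ofReal_mem_slitPlane.2 (adelicAbsDet_pos x)

variable [MeasurableSpace (GL (Fin n) (AdeleRing (𝓞 K) K))] [BorelSpace (GL (Fin n) (AdeleRing (𝓞 K) K))]
  [MeasurableSpace (awayFactor K n T)] [BorelSpace (awayFactor K n T)]
  [MeasurableSpace (placesFactor K n T)] [BorelSpace (placesFactor K n T)]
  (μH : Measure (awayFactor K n T)) (μG : Measure (placesFactor K n T))
  [μH.IsHaarMeasure] [μG.IsHaarMeasure]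

variable (K n T) in
/-- The measure `dh ⊗ da` on `GL_n(𝔸_K)` transported along `GL_n(𝔸_K) = H^T · G_T` from Haar
measures on the two factors. [folklore] -/
def awayProductMeasure : Measure (GL (Fin n) (AdeleRing (𝓞 K) K)) :=
  (μH.prod μG).map (awayDecomp K n T).symm

/-- **`dh ⊗ da` is a Haar measure on `GL_n(𝔸_K)`** (Mathlib: a product of Haar measures is a Haar
measure, and Haar measures transport along isomorphisms of topological groups). [folklore] -/
theorem isHaarMeasure_awayProductMeasure : (awayProductMeasure K n T μH μG).IsHaarMeasure := by
  haveI := locallyCompactSpace_awayFactor K n T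
  haveI := locallyCompactSpace_placesFactor K n T
  haveI := secondCountableTopology_awayFactor K n T
  haveI := secondCountableTopology_placesFactor K n T
  exact (awayDecomp K n T).symm.isHaarMeasure_map (μH.prod μG)

/-- **Unfolding the Godement–Jacquet integral along `GL_n(𝔸_K) = H^T · G_T`.** Let `Π` be
cuspidal with Satake family `α` off `T`, `0 ≠ φ ∈ Π^{K^T}`, `φ' ∈ L²`, `re s ≥ n² + n + 2`, and let
`Φ : M_n(𝔸_K) → ℂ` be continuous on `GL_n(𝔸_K)` and factor as `Φ(h a) = 1_{Δ^T}(h) Φ_G(a)`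
(`h ∈ H^T`, `a ∈ G_T`) with `∫_{G_T} |Φ_G(a)| |det a|_𝔸^{re s} da < ∞`. Then for the Haar measure
`dh ⊗ da` the zeta integrand is integrable and
`Z(Φ, s, φ, φ') = vol(K^T) · (∏_{w ∉ T} (∏_{a ∈ α w} (1 - q_w^{(n-1)/2} a q_w^{-s}))⁻¹) ·
∫_{G_T} Φ_G(a) ⟪φ', R(a) φ⟫ |det a|_𝔸^s da`
(Fubini; for fixed `a` the vector `R(a) φ` is again `K^T`-fixed, and the integral over `H^T` is the
coset integral `integral_indicator_unfold_awayFactor`). Godement–Jacquet (1972), proof of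
Thm. 13.8 (`Z = ∏_v Z_v` with the unramified factors `L(s - (n-1)/2, Π_w)`), obtained here without
the tensor-product theorem. [cite: GodementJacquet1972, Thm. 13.8 (proof)] -/
theorem gjZeta_awayProductMeasure_eq (P : CuspidalAutomorphicRepGL n K μ) {α : SatakeFamily K}
    (hα : IsSatakeFamilyOf P (↑T : Set (HeightOneSpectrum (𝓞 K))) α)
    {φ : (AdelicGroupData.gl n K).L2 μ} (hφP : φ ∈ P.1) (hφ0 : φ ≠ 0)
    (hφ : ∀ k ∈ awayLevel K n T, (AdelicGroupData.gl n K).rightRegular μ k φ = φ)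
    (φ' : (AdelicGroupData.gl n K).L2 μ) {s : ℂ} (hs : (n : ℝ) * n + n + 2 ≤ s.re)
    (Φ : Matrix (Fin n) (Fin n) (AdeleRing (𝓞 K) K) → ℂ) (ΦG : placesFactor K n T → ℂ)
    (hΦ : ∀ (h : awayFactor K n T) (a : placesFactor K n T),
      Φ ((h : GL (Fin n) (AdeleRing (𝓞 K) K)) * (a : GL (Fin n) (AdeleRing (𝓞 K) K)) : GL (Fin n) (AdeleRing (𝓞 K) K)) =
        if IsIntegralAway h then ΦG a else 0)
    (hΦc : Continuous fun x : GL (Fin n) (AdeleRing (𝓞 K) K) => Φ x)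
    (hΦG : Integrable (fun a : placesFactor K n T =>
      ‖ΦG a‖ * (adelicAbsDet n K (a : GL (Fin n) (AdeleRing (𝓞 K) K)) : ℝ) ^ s.re) μG) :
    Integrable (gjZetaIntegrand μ Φ φ φ' s) (awayProductMeasure K n T μH μG) ∧
      gjZeta μ (awayProductMeasure K n T μH μG) Φ φ φ' s =
        ((μH (awayLevelIn K n T)).toReal : ℂ) *
          (∏' i : {w : HeightOneSpectrum (𝓞 K) // w ∉ T}, localEulerInv n (α i.1) i.1 s) *
            ∫ a : placesFactor K n T, ΦG a * glMatrixCoeff μ φ φ' (a : GL (Fin n) (AdeleRing (𝓞 K) K)) *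
              ((adelicAbsDet n K (a : GL (Fin n) (AdeleRing (𝓞 K) K)) : ℝ) : ℂ) ^ s ∂μG := by
  haveI := locallyCompactSpace_awayFactor K n T
  haveI := locallyCompactSpace_placesFactor K n T
  haveI := secondCountableTopology_awayFactor K n T
  haveI := secondCountableTopology_placesFactor K n T
  set e := awayDecomp K n T with he
  set f : GL (Fin n) (AdeleRing (𝓞 K) K) → ℂ := gjZetaIntegrand μ Φ φ φ' s with hf
  set g : awayFactor K n T × placesFactor K n T → ℂ := fun p => f (e.symm p) with hg
  -- the integrand along the decomposition
  have hg_eq : ∀ (h : awayFactor K n T) (a : placesFactor K n T), g (h, a) =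
      (({x : awayFactor K n T | IsIntegralAway x}.indicator (fun h =>
        ((adelicAbsDet n K (h : GL (Fin n) (AdeleRing (𝓞 K) K)) : ℝ) : ℂ) ^ s *
          ⟪φ', (AdelicGroupData.gl n K).rightRegular μ (h : GL (Fin n) (AdeleRing (𝓞 K) K))
            ((AdelicGroupData.gl n K).rightRegular μ (a : GL (Fin n) (AdeleRing (𝓞 K) K)) φ)⟫_ℂ) h) *
        (ΦG a * ((adelicAbsDet n K (a : GL (Fin n) (AdeleRing (𝓞 K) K)) : ℝ) : ℂ) ^ s)) := by
    intro h a
    rw [hg, hf]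
    dsimp only
    rw [awayDecomp_symm_apply, gjZetaIntegrand, hΦ, glMatrixCoeff_apply, rightRegular_mul_apply, map_mul,
      NNReal.coe_mul, Complex.ofReal_mul,
      Complex.mul_cpow_ofReal_nonneg (NNReal.coe_nonneg _) (NNReal.coe_nonneg _)]
    by_cases hh : IsIntegralAway h
    · rw [if_pos hh, Set.indicator_of_mem (show h ∈ {x : awayFactor K n T | IsIntegralAway x} from hh)]
      ring
    · rw [if_neg hh, Set.indicator_of_notMem (show h ∉ {x : awayFactor K n T | IsIntegralAway x} from hh)]
      ring
  -- measurability of `g`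
  have hfc : Continuous f := by
    rw [hf]
    unfold gjZetaIntegrand
    exact (hΦc.mul (continuous_glMatrixCoeff φ φ')).mul (continuous_adelicAbsDet_cpow s)
  have hgm : AEStronglyMeasurable g (μH.prod μG) := (hfc.comp e.symm.continuous).aestronglyMeasurable
  -- integrability of `g` by the product majorant
  have hwt := (integrable_indicator_adelicAbsDet_rpow (T := T) μH hs).1
  have hB := (hwt.mul_const (‖φ'‖ * ‖φ‖)).mul_prod hΦG
  have hgi : Integrable g (μH.prod μG) := by
    refine hB.mono' hgm (Eventually.of_forall fun p => ?_)
    obtain ⟨h, a⟩ := p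
    rw [hg_eq]
    dsimp only
    rw [norm_mul, norm_mul, Complex.norm_cpow_eq_rpow_re_of_pos (adelicAbsDet_pos _)]
    refine mul_le_mul ?_ (le_of_eq (by ring)) (by positivity)
      (mul_nonneg (Set.indicator_nonneg (fun _ _ => Real.rpow_nonneg (NNReal.coe_nonneg _) _) _) (by positivity))
    by_cases hh : h ∈ {x : awayFactor K n T | IsIntegralAway x}
    · rw [Set.indicator_of_mem hh, Set.indicator_of_mem hh, norm_mul,
        Complex.norm_cpow_eq_rpow_re_of_pos (adelicAbsDet_pos _)]
      refine mul_le_mul_of_nonneg_left ?_ (by positivity)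
      rw [← AdelicGroupData.norm_rightRegular_apply (𝒢 := AdelicGroupData.gl n K) μ
        (a : GL (Fin n) (AdeleRing (𝓞 K) K)) φ, ← AdelicGroupData.norm_rightRegular_apply
        (𝒢 := AdelicGroupData.gl n K) μ (h : GL (Fin n) (AdeleRing (𝓞 K) K))
        ((AdelicGroupData.gl n K).rightRegular μ (a : GL (Fin n) (AdeleRing (𝓞 K) K)) φ)]
      exact norm_inner_le_norm _ _
    · rw [Set.indicator_of_notMem hh, Set.indicator_of_notMem hh, norm_zero, zero_mul]
  -- transport to `GL_n(𝔸_K)`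
  have hmeas : AEMeasurable (fun p : awayFactor K n T × placesFactor K n T => e.symm p) (μH.prod μG) :=
    (show Continuous fun p : awayFactor K n T × placesFactor K n T => e.symm p from e.symm.continuous).aemeasurable
  have hfm : AEStronglyMeasurable f (awayProductMeasure K n T μH μG) := hfc.aestronglyMeasurable
  have hfi : Integrable f (awayProductMeasure K n T μH μG) := (integrable_map_measure hfm hmeas).2 hgi
  refine ⟨hfi, ?_⟩
  rw [gjZeta, awayProductMeasure, integral_map hmeas hfm, integral_prod_symm _ hgi]
  -- the inner integral over `H^T`
  have hinner : ∀ a : placesFactor K n T, ∫ h, g (h, a) ∂μH =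
      ((μH (awayLevelIn K n T)).toReal : ℂ) *
        ((∏' i : {w : HeightOneSpectrum (𝓞 K) // w ∉ T}, localEulerInv n (α i.1) i.1 s) *
          glMatrixCoeff μ φ φ' (a : GL (Fin n) (AdeleRing (𝓞 K) K))) *
        (ΦG a * ((adelicAbsDet n K (a : GL (Fin n) (AdeleRing (𝓞 K) K)) : ℝ) : ℂ) ^ s) := by
    intro a
    have h1 := (integral_indicator_unfold_awayFactor (T := T) μH P hα (P.1.apply_mem _ hφP)
      (rightRegular_apply_ne_zero hφ0 _) (rightRegular_placesFactor_fixed hφ a) φ' hs).2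
    simp_rw [hg_eq]
    rw [integral_mul_const, h1, glMatrixCoeff_apply]
  simp_rw [hinner]
  rw [← integral_const_mul]
  refine integral_congr_ae (Eventually.of_forall fun a => ?_)
  ring

end Product

end Literature.NumberTheory.Automorphic
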